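import Literature.AnabelianGeometry.AbsoluteAnabelian.AbsTopIII.FrobeniusPictureMLFTelecore

/-!
# [AbsTopIII] Corollary 3.6 (iv), second incompatibility: DERIVED from the Lemma-3.4 obstruction

S. Mochizuki, *Topics in Absolute Anabelian Geometry III*, Cor. 3.6 (iv) and its proof, pp. 80–82
of the manuscript `paper:url-5493eb38cbb7` (bib key `MochizukiAbsTopIII2015`).  Companion of
`AbsTopIII/FrobeniusPictureMLFTelecore.lean` (block W2-B1, node `AbsTopIII:Cor3.6(iv)`).

Cor. 3.6 (iv), second sentence: "the telecore structure `𝔗_An` of (ii), the contact structure `ℋ_An`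
of (ii), and the observable `𝔖_log` of (iii) are not simultaneously compatible".  Proof (p. 82):
in a common family of homotopies, "applying the homotopy `η_{□⋎+1}` of the contact structure `ℋ_An`
yields a homotopy `[φ_□] ⇝ [id_{⋎+1}]∘[φ_{⋎+1}]`; on the other hand, we obtain a homotopy
`[φ_□] ⇝ [id_⋎]∘[φ_⋎] ⇝ [id_⋎]∘[β¹_⋎]∘[log]∘[φ_{⋎+1}] ⇝ [id_⋎]∘[log]∘[φ_{⋎+1}]` by applying the
homotopy `η_{□⋎}` of the contact structure `ℋ_An`, followed by the homotopies of the telecore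
`𝔗_An`, followed by the homotopy `η_⋎` of the contact structure `ℋ_An`.  Thus, by applying the
argument applied in the proof of the first incompatibility, we obtain two mutually contradictory
homotopies `[λ^×]∘[φ_□] ⇝ [λ^{×pf}]∘[id_{⋎+1}]∘[φ_{⋎+1}]`."

This file: (1) the Lemma-3.4 obstruction as a PROPERTY OF THE ABSTRACT DATA `Δ` (`Lemma34Property`;
for the MLF-Galois data of Def. 3.1 it is Lemma 3.4 p. 74); (2) "the argument applied in the proof
of the first incompatibility" BEHIND A PREFIX EDGE, for an arbitrary family of homotopies on an
arbitrary diagram of categories (`false_of_prefixed_core_compatible_of_obstruction_left`; adapted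
from abc-iut-L4-t10's unprefixed `false_of_core_compatible_of_obstruction_left` in
`AutHolLogFrobeniusIncompatibility.lean`, whose `eqToHom` bookkeeping it follows); (3) the printed
chain of homotopies, run inside an arbitrary common family from the contact generators
(`ContactGen`), the telecore boundary set (`Telecore.boundary_iff`) and saturation, yielding the
typed second incompatibility `LogFrobeniusData.TelecoreIncompatibleStmt` from `Lemma34Property`
(`telecoreIncompatibleStmt_of_lemma34`).  The first sentence (`IncompatibleStmt`) is derived in
`FrobeniusPictureMLFIncompatibility.lean`.  Nothing here takes a side on inter-universal
Teichmüller theory.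
-/

namespace Literature.AnabelianGeometry.AbsoluteAnabelian.LogFrobeniusData

open _root_.CategoryTheory _root_.Quiver

universe u

variable {Δ : LogFrobeniusData.{u}}

/-- **The component-level content of Lemma 3.4** for abstract MLF-Galois input data ("by writing
out explicitly the meaning of such an equality `ζ'₁ = ζ₂`", proof of Cor. 3.6 (iv) p. 81): for every
object `x` of the first row and every ISOMORPHISM `a : id_{⋎+1}(x) ⥲ id_⋎(log x)` of `𝒳` — inducing an
isomorphism of topological groups "`α : k^× ⥲ (k~)^×`" on arithmetic data — the composite
`λ^×(a) ≫ ι_{log,⋎}(x)`, i.e. "`k^× →α (k~)^× ↪ (k^×)^pf`", is NOT the natural map `ι_×(x)`, i.e.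
"`k^× → (k^×)^pf`" (Lemma 3.4 p. 74: the former lands in `(𝒪_k^×)^pf`, the latter does not on
`𝒪^▷_k`).  A property of the data `Δ` (with `ι_× = ι`); for the data of Def. 3.1 it is Lemma 3.4
(`pow_not_mem_unitSubmonoid_of_preserves` in seat abc-iut-L4-t2's `MLFGaloisModel.lean` is its
algebraic residue). [cite: MochizukiAbsTopIII2015, Lemma 3.4 p.74] -/
def Lemma34Property (ι : Δ.lamTimes ⟶ Δ.lamPf) : Prop :=
  ∀ (x : Δ.X₁) (a : Δ.toNexus.obj x ⟶ Δ.toNexus.obj (Δ.log.obj x)), IsIso a →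
    Δ.lamTimes.map a ≫ Δ.ιlog.app x ≠ ι.app (Δ.toNexus.obj x)

/-! ### The second incompatibility: the same argument behind a telecore edge -/

section Prefixed

universe v' u' w' v₁ v₂ u₁ u₂

/-- Components of a natural transformation at propositionally equal objects. [folklore] -/
private theorem app_eq_of_obj_eq' {C : Type u₁} [Category.{v₁} C] {C' : Type u₂} [Category.{v₂} C']
    {F G : C ⥤ C'} (θ : F ⟶ G) {X Y : C} (h : X = Y) :
    θ.app X = eqToHom (by rw [h]) ≫ θ.app Y ≫ eqToHom (by rw [h]) := by
  subst h
  simp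

/-- Conjugating an identity by `eqToHom` gives an identity. [folklore] -/
private theorem eqToHom_conj_eq_id' {C : Type u₁} [Category.{v₁} C] {X Y : C} (h : X = Y) {f : X ⟶ X}
    (hf : f = 𝟙 X) : eqToHom h.symm ≫ f ≫ eqToHom h = 𝟙 Y := by
  subst hf
  simp

/-- Merging the `eqToHom`s of a singly nested conjugate. [folklore] -/
private theorem eqToHom_sandwich' {C : Type u₁} [Category.{v₁} C] {A B₁ B₂ C₁ C₂ E : C} (p : A = B₁)
    (q : B₁ = B₂) (m : B₂ ⟶ C₁) (r : C₁ = C₂) (s : C₂ = E) :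
    eqToHom p ≫ (eqToHom q ≫ m ≫ eqToHom r) ≫ eqToHom s =
      eqToHom (p.trans q) ≫ m ≫ eqToHom (r.trans s) := by
  cases p; cases q; cases r; cases s; simp

/-- Merging the `eqToHom`s of a doubly nested conjugate. [folklore] -/
private theorem eqToHom_sandwich₂' {C : Type u₁} [Category.{v₁} C] {A B₁ B₂ B₃ C₁ C₂ C₃ E : C}
    (p : A = B₁) (q : B₁ = B₂) (q' : B₂ = B₃) (m : B₃ ⟶ C₁) (r : C₁ = C₂) (r' : C₂ = C₃) (s : C₃ = E) :
    eqToHom p ≫ (eqToHom q ≫ (eqToHom q' ≫ m ≫ eqToHom r) ≫ eqToHom r') ≫ eqToHom s =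
      eqToHom (p.trans (q.trans q')) ≫ m ≫ eqToHom (r.trans (r'.trans s)) := by
  cases p; cases q; cases q'; cases r; cases r'; cases s; simp

/-- Normalising lemma (left-hand side of the forced equation). [folklore] -/
private theorem eqToHom_sandwich_left' {C : Type u₁} [Category.{v₁} C] {A S B C₁ C₂ T Y Y' : C}
    (a : A = S) (p : S = B) (m : B ⟶ C₁) (q : C₁ = C₂) (r : C₂ = T) (f : T ⟶ Y) (b : Y = Y')
    (b' : Y' = Y) :
    eqToHom a ≫ ((eqToHom p ≫ m ≫ eqToHom q) ≫ (eqToHom r ≫ f ≫ eqToHom b)) ≫ eqToHom b' =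
      eqToHom (a.trans p) ≫ m ≫ eqToHom (q.trans r) ≫ f := by
  cases a; cases p; cases q; cases r; cases b; simp

/-- Normalising lemma (right-hand side of the forced equation). [folklore] -/
private theorem eqToHom_sandwich_right' {C : Type u₁} [Category.{v₁} C] {A S A' Y Y' : C}
    (a : A = S) (r : S = A') (g : A' ⟶ Y) (b : Y = Y') (b' : Y' = Y) :
    eqToHom a ≫ (eqToHom r ≫ g ≫ eqToHom b) ≫ eqToHom b' = eqToHom (a.trans r) ≫ g := by
  cases a; cases r; cases b; simp

/-- **The argument of the second incompatibility (proof of Cor. 3.6 (iv), pp. 81–82), for an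
arbitrary family of homotopies on an arbitrary diagram of categories — the version of
abc-iut-L4-t10's `false_of_core_compatible_of_obstruction_left` BEHIND A PREFIX EDGE `f : w → v₁`
(in Cor. 3.6: a telecore edge `φ_{⋎+1} : Anab → 𝒳`).**  If `K` contains an ISOMORPHISM for the pair
`([id₁]∘[f], [id₀]∘[log]∘[f])` ("two mutually contradictory homotopies … `[λ^×]∘[φ_□] ⇝ …`", p. 82),
the pair `([λ^×],[λ^{×pf}])` with components `ι_×` and the type-(1) pair with components `ι_log`,
then at the object `x₀ = f(a₀)` the forced equation `λ^×(α) ≫ ι_log(x₀) = ι_×(id₁ x₀)` holds for the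
isomorphism `α = ζ(a₀)`; a component-level obstruction (Lemma 3.4) at `x₀` yields a contradiction.
[cite: MochizukiAbsTopIII2015, Corollary 3.6 (iv) p.82] -/
theorem false_of_prefixed_core_compatible_of_obstruction_left {V : Type w'} [Quiver.{v'} V]
    {D : DiagramOfCategories.{v', u', w'} V} (K : D.HomotopyFamily) {w v1 v0 sq ob : V}
    (f : w ⟶ v1) (eLog : v1 ⟶ v0) (eId1 : v1 ⟶ sq) (eId0 : v0 ⟶ sq) (eT eP : sq ⟶ ob)
    (ιt : D.map eT ⟶ D.map eP)
    (ιl : (D.map eLog ⋙ D.map eId0) ⋙ D.map eT ⟶ D.map eId1 ⋙ D.map eP)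
    (h₀ : K.E (((Path.nil : Path w w).cons f).cons eId1)
      ((((Path.nil : Path w w).cons f).cons eLog).cons eId0))
    (hiso : IsIso (K.η h₀))
    (hT : K.E ((Path.nil : Path sq sq).cons eT) ((Path.nil : Path sq sq).cons eP))
    (hhT : ∀ (x : D.obj sq)
      (e₁ : (D.pathFunctor ((Path.nil : Path sq sq).cons eT)).obj x = (D.map eT).obj x)
      (e₂ : (D.pathFunctor ((Path.nil : Path sq sq).cons eP)).obj x = (D.map eP).obj x),
      (K.η hT).app x = eqToHom e₁ ≫ ιt.app x ≫ eqToHom e₂.symm)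
    (h₁ : K.E ((((Path.nil : Path v1 v1).cons eLog).cons eId0).cons eT)
      (((Path.nil : Path v1 v1).cons eId1).cons eP))
    (hh₁ : ∀ (x : D.obj v1)
      (e₁ : (D.pathFunctor ((((Path.nil : Path v1 v1).cons eLog).cons eId0).cons eT)).obj x =
        (D.map eT).obj ((D.map eId0).obj ((D.map eLog).obj x)))
      (e₂ : (D.pathFunctor (((Path.nil : Path v1 v1).cons eId1).cons eP)).obj x =
        (D.map eP).obj ((D.map eId1).obj x)),
      (K.η h₁).app x = eqToHom e₁ ≫ ιl.app x ≫ eqToHom e₂.symm)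
    (a₀ : D.obj w)
    (obstruction : ∀ (a : (D.map eId1).obj ((D.map f).obj a₀) ⟶
        (D.map eId0).obj ((D.map eLog).obj ((D.map f).obj a₀))), IsIso a →
      (D.map eT).map a ≫ ιl.app ((D.map f).obj a₀) ≠ ιt.app ((D.map eId1).obj ((D.map f).obj a₀))) :
    False := by
  -- functor identifications along the explicit paths (equation lemmas of `pathFunctor`)
  have E0 : D.pathFunctor (Path.nil : Path w w) = 𝟭 _ := DiagramOfCategories.pathFunctor_nil _ _
  have E0v : D.pathFunctor (Path.nil : Path v1 v1) = 𝟭 _ := DiagramOfCategories.pathFunctor_nil _ _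
  have E0' : D.pathFunctor (Path.nil : Path ob ob) = 𝟭 _ := DiagramOfCategories.pathFunctor_nil _ _
  have ET : D.pathFunctor ((Path.nil : Path sq sq).cons eT) = D.map eT := by
    rw [DiagramOfCategories.pathFunctor_cons, DiagramOfCategories.pathFunctor_nil, Functor.id_comp]
  have EP : D.pathFunctor ((Path.nil : Path sq sq).cons eP) = D.map eP := by
    rw [DiagramOfCategories.pathFunctor_cons, DiagramOfCategories.pathFunctor_nil, Functor.id_comp]
  have EF : D.pathFunctor ((Path.nil : Path w w).cons f) = D.map f := by
    rw [DiagramOfCategories.pathFunctor_cons, DiagramOfCategories.pathFunctor_nil, Functor.id_comp]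
  have E1 : D.pathFunctor (((Path.nil : Path w w).cons f).cons eId1) = D.map f ⋙ D.map eId1 := by
    rw [DiagramOfCategories.pathFunctor_cons, EF]
  have E2 : D.pathFunctor ((((Path.nil : Path w w).cons f).cons eLog).cons eId0) =
      (D.map f ⋙ D.map eLog) ⋙ D.map eId0 := by
    rw [DiagramOfCategories.pathFunctor_cons, DiagramOfCategories.pathFunctor_cons, EF]
  have E3 : D.pathFunctor ((((Path.nil : Path w w).cons f).cons eId1).cons eT) =
      (D.map f ⋙ D.map eId1) ⋙ D.map eT := by
    rw [DiagramOfCategories.pathFunctor_cons, E1]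
  have E4 : D.pathFunctor ((((Path.nil : Path w w).cons f).cons eId1).cons eP) =
      (D.map f ⋙ D.map eId1) ⋙ D.map eP := by
    rw [DiagramOfCategories.pathFunctor_cons, E1]
  have E5 : D.pathFunctor (((((Path.nil : Path w w).cons f).cons eLog).cons eId0).cons eT) =
      ((D.map f ⋙ D.map eLog) ⋙ D.map eId0) ⋙ D.map eT := by
    rw [DiagramOfCategories.pathFunctor_cons, E2]
  have U4 : D.pathFunctor (((Path.nil : Path v1 v1).cons eId1).cons eP) = D.map eId1 ⋙ D.map eP := by
    rw [DiagramOfCategories.pathFunctor_cons, DiagramOfCategories.pathFunctor_cons, E0v,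
      Functor.id_comp]
  have U5 : D.pathFunctor ((((Path.nil : Path v1 v1).cons eLog).cons eId0).cons eT) =
      (D.map eLog ⋙ D.map eId0) ⋙ D.map eT := by
    rw [DiagramOfCategories.pathFunctor_cons, DiagramOfCategories.pathFunctor_cons,
      DiagramOfCategories.pathFunctor_cons, E0v, Functor.id_comp]
  -- the three homotopies of the chain, all behind the prefix `f`
  have s1 : K.E (((((Path.nil : Path w w).cons f).cons eId1)).cons eT)
      (((((Path.nil : Path w w).cons f).cons eLog).cons eId0).cons eT) :=
    K.isSaturated.precomp (K.isSaturated.postcomp h₀ ((Path.nil : Path sq sq).cons eT)) Path.nil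
  have h₁' : K.E (((((Path.nil : Path w w).cons f).cons eLog).cons eId0).cons eT)
      ((((Path.nil : Path w w).cons f).cons eId1).cons eP) :=
    K.isSaturated.precomp (K.isSaturated.postcomp h₁ Path.nil) ((Path.nil : Path w w).cons f)
  have s3 : K.E ((((Path.nil : Path w w).cons f).cons eId1).cons eT)
      ((((Path.nil : Path w w).cons f).cons eId1).cons eP) :=
    K.isSaturated.precomp (K.isSaturated.postcomp hT Path.nil)
      (((Path.nil : Path w w).cons f).cons eId1)
  -- homotopies of the same pair coincide
  have kapp : (K.η s1).app a₀ ≫ (K.η h₁').app a₀ = (K.η s3).app a₀ := by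
    rw [← NatTrans.comp_app, ← K.η_trans s1 h₁']
  -- the whiskering axiom of Def. 3.5 (ii) (b)
  have W1 := K.η_whisker h₀ (Path.nil : Path w w) ((Path.nil : Path sq sq).cons eT)
  have W2 := K.η_whisker h₁ ((Path.nil : Path w w).cons f) (Path.nil : Path ob ob)
  have W3 := K.η_whisker hT (((Path.nil : Path w w).cons f).cons eId1) (Path.nil : Path ob ob)
  -- object identifications at `a₀`
  have hx0 : (D.pathFunctor (Path.nil : Path w w)).obj a₀ = a₀ := Functor.congr_obj E0 a₀
  have hxf : (D.pathFunctor ((Path.nil : Path w w).cons f)).obj a₀ = (D.map f).obj a₀ :=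
    Functor.congr_obj EF a₀
  have hx1 : (D.pathFunctor (((Path.nil : Path w w).cons f).cons eId1)).obj a₀ =
      (D.map eId1).obj ((D.map f).obj a₀) := Functor.congr_obj E1 a₀
  have o2 : (D.pathFunctor ((((Path.nil : Path w w).cons f).cons eLog).cons eId0)).obj a₀ =
      (D.map eId0).obj ((D.map eLog).obj ((D.map f).obj a₀)) := Functor.congr_obj E2 a₀
  have o3 : (D.pathFunctor ((((Path.nil : Path w w).cons f).cons eId1).cons eT)).obj a₀ =
      (D.map eT).obj ((D.map eId1).obj ((D.map f).obj a₀)) := Functor.congr_obj E3 a₀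
  have M₁ : (D.pathFunctor ((((Path.nil : Path w w).cons f).cons eId1).cons eT)).obj a₀ =
      (D.map eT).obj ((D.pathFunctor (((Path.nil : Path w w).cons f).cons eId1)).obj a₀) := by
    rw [E3, E1]; rfl
  have M₂ : (D.map eT).obj
        ((D.pathFunctor ((((Path.nil : Path w w).cons f).cons eLog).cons eId0)).obj a₀) =
      (D.pathFunctor (((((Path.nil : Path w w).cons f).cons eLog).cons eId0).cons eT)).obj a₀ := by
    rw [E5, E2]; rfl
  have N₁ : (D.pathFunctor (((((Path.nil : Path w w).cons f).cons eLog).cons eId0).cons eT)).obj a₀ =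
      (D.map eT).obj ((D.map eId0).obj ((D.map eLog).obj ((D.map f).obj a₀))) :=
    Functor.congr_obj E5 a₀
  have N₂ : (D.map eP).obj ((D.map eId1).obj ((D.map f).obj a₀)) =
      (D.pathFunctor ((((Path.nil : Path w w).cons f).cons eId1).cons eP)).obj a₀ :=
    (Functor.congr_obj E4 a₀).symm
  -- ζ'₀ behind the prefix: λ^×(ζ(a₀))
  have W1x := NatTrans.congr_app W1 a₀
  simp only [NatTrans.comp_app, eqToHom_app, Functor.whiskerLeft_app, Functor.whiskerRight_app,
    Functor.congr_hom ET, app_eq_of_obj_eq' (K.η h₀) hx0, Functor.map_comp, eqToHom_map,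
    Category.assoc, eqToHom_trans, eqToHom_trans_assoc] at W1x
  have W1c : (K.η s1).app a₀ = eqToHom M₁ ≫ (D.map eT).map ((K.η h₀).app a₀) ≫ eqToHom M₂ :=
    W1x.trans (eqToHom_sandwich' _ _ _ _ _)
  -- ζ₁ behind the prefix: ι_log(f a₀)
  have W2x := NatTrans.congr_app W2 a₀
  simp only [NatTrans.comp_app, eqToHom_app, Functor.whiskerLeft_app, Functor.whiskerRight_app,
    Functor.congr_hom E0', Functor.id_map, app_eq_of_obj_eq' (K.η h₁) hxf,
    hh₁ ((D.map f).obj a₀) (Functor.congr_obj U5 _) (Functor.congr_obj U4 _),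
    Category.assoc, eqToHom_trans, eqToHom_trans_assoc] at W2x
  have W2c : (K.η h₁').app a₀ = eqToHom N₁ ≫
      (ιl.app ((D.map f).obj a₀) :
        (D.map eT).obj ((D.map eId0).obj ((D.map eLog).obj ((D.map f).obj a₀))) ⟶
          (D.map eP).obj ((D.map eId1).obj ((D.map f).obj a₀))) ≫ eqToHom N₂ :=
    W2x.trans (eqToHom_sandwich₂' _ _ _ _ _ _ _)
  -- ζ₂ behind the prefix: ι_×(id₁ (f a₀))
  have W3x := NatTrans.congr_app W3 a₀
  simp only [NatTrans.comp_app, eqToHom_app, Functor.whiskerLeft_app, Functor.whiskerRight_app,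
    Functor.congr_hom E0', Functor.id_map, app_eq_of_obj_eq' (K.η hT) hx1,
    hhT ((D.map eId1).obj ((D.map f).obj a₀)) (Functor.congr_obj ET _) (Functor.congr_obj EP _),
    Category.assoc, eqToHom_trans, eqToHom_trans_assoc] at W3x
  have W3c : (K.η s3).app a₀ =
      eqToHom o3 ≫ ιt.app ((D.map eId1).obj ((D.map f).obj a₀)) ≫ eqToHom N₂ :=
    W3x.trans (eqToHom_sandwich₂' _ _ _ _ _ _ _)
  rw [W1c, W2c, W3c] at kapp
  have k5 := ((eqToHom_sandwich_left' o3.symm M₁ _ M₂ N₁ _ N₂ N₂.symm).symm.trans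
    ((congrArg (fun t => eqToHom o3.symm ≫ t ≫ eqToHom N₂.symm) kapp).trans
      (eqToHom_sandwich_right' o3.symm o3 _ N₂ N₂.symm)))
  simp only [eqToHom_refl, Category.id_comp] at k5
  haveI := hiso
  refine obstruction (eqToHom hx1.symm ≫ (K.η h₀).app a₀ ≫ eqToHom o2) inferInstance ?_
  simp only [Functor.map_comp, eqToHom_map, Category.assoc]
  exact k5

end Prefixed

/-- **Cor. 3.6 (iv), second incompatibility, from Lemma 3.4**: "the telecore structure `𝔗_An` of
(ii), the contact structure `ℋ_An` of (ii), and the observable `𝔖_log` of (iii) are not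
simultaneously compatible", in the typed form `LogFrobeniusData.TelecoreIncompatibleStmt`, for
input data of MLF-Galois type (`ι_× = ι`, §3 direction) with an object `a₀` of `Anab` and the
Lemma-3.4 property.  The proof is the printed one (p. 82): in a common family `K`, "applying the
homotopy `η_{□⋎+1}` of the contact structure `ℋ_An` yields a homotopy `[φ_□] ⇝ [id_{⋎+1}]∘[φ_{⋎+1}]`;
on the other hand, we obtain a homotopy `[φ_□] ⇝ [id_⋎]∘[φ_⋎] ⇝ [id_⋎]∘[β¹_⋎]∘[log]∘[φ_{⋎+1}]
⇝ [id_⋎]∘[log]∘[φ_{⋎+1}]` by applying the homotopy `η_{□⋎}` of the contact structure `ℋ_An`, followed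
by the homotopies of the telecore `𝔗_An`, followed by the homotopy `η_⋎` of the contact structure
`ℋ_An`" — an ISOMORPHISM for the pair `([id_{⋎+1}]∘[φ_{⋎+1}], [id_⋎]∘[log]∘[φ_{⋎+1}])` (both
orientations lie in `K`) — and then "the argument applied in the proof of the first
incompatibility" behind the prefix `φ_{⋎+1}` (`false_of_prefixed_core_compatible_of_obstruction_left`)
contradicts the Lemma-3.4 property at `φ_{⋎+1}(a₀)`.
[cite: MochizukiAbsTopIII2015, Corollary 3.6 (iv) p.82] -/
theorem telecoreIncompatibleStmt_of_lemma34 (τ : Δ.TelecoreData) (ι : Δ.lamTimes ⟶ Δ.lamPf)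
    (hι : Δ.ιtimes = Sum.inl ι) (a₀ : Δ.A) (h34 : Lemma34Property ι) :
    Δ.TelecoreIncompatibleStmt τ := by
  intro H hH hc T hT
  rintro ⟨K, hJ, hC, htimes, hlog⟩
  -- telecore edges at `□`, `⋎ = 0 + 1`, `⋎ = 0`
  obtain ⟨jsq⟩ := (hT.edges_iff (vx 4 .nexus (by decide))).mpr (by decide)
  obtain ⟨j1⟩ := (hT.edges_iff (vx 4 (.row1 (0 + 1)) (by simp [LFVertex.row]))).mpr
    (by simp [vx, LFVertex.row])
  obtain ⟨j0⟩ := (hT.edges_iff (vx 4 (.row1 0) (by simp [LFVertex.row]))).mpr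
    (by simp [vx, LFVertex.row])
  -- the `𝔖_log` generators inside `K`
  rw [hι] at htimes
  obtain ⟨hTm, hhTm⟩ := htimes
  obtain ⟨h₁, hh₁⟩ := hlog 0
  -- the telecore loop `Anab → (⋎+1) → ⋎ → □ → 𝒩 → ℰ → Anab`
  let loop : Path (tvObs T.J) (tvObs T.J) :=
    ((((((Path.nil : Path (tvObs T.J) (tvObs T.J)).cons (ePhi j1)).cons
      (show tvRow1 T.J (0 + 1) ⟶ tvRow1 T.J 0 from LFVertex.logEdge 0)).cons
      (show tvRow1 T.J 0 ⟶ tvNexus T.J from LFVertex.idEdge 0)).cons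
      (show tvNexus T.J ⟶ tvThird T.J from LFVertex.lamTimesEdge)).cons
      (show tvThird T.J ⟶ tvFourth T.J from LFVertex.edge34)).cons
      (show tvFourth T.J ⟶ tvObs T.J from (PUnit.unit : coreI5.{u} (vx 4 .fourth (by decide))))
  -- (1) `η_{□,⋎+1}⁻¹ : [id_{⋎+1}]∘[φ_{⋎+1}] ⇝ [φ_□]`, (2) `η_{□⋎} : [φ_□] ⇝ [id_⋎]∘[φ_⋎]`
  have c1 : K.E (pathPhiId (0 + 1) j1) (pathPhiNexus jsq) := hC _ _ (ContactGen.etaSqInv (0 + 1) jsq j1)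
  have c2 : K.E (pathPhiNexus jsq) (pathPhiId 0 j0) := hC _ _ (ContactGen.etaSq 0 jsq j0)
  have c1' : K.E (pathPhiNexus jsq) (pathPhiId (0 + 1) j1) := hC _ _ (ContactGen.etaSq (0 + 1) jsq j1)
  have c2' : K.E (pathPhiId 0 j0) (pathPhiNexus jsq) := hC _ _ (ContactGen.etaSqInv 0 jsq j0)
  -- (3) the telecore homotopy `[φ_⋎] ⇝ [φ_⋎]∘(loop)`, post-composed with `[id_⋎]`
  have t3 : T.Jfam.E ((Path.nil : Path (tvObs T.J) (tvObs T.J)).cons (ePhi j0)) (loop.cons (ePhi j0)) :=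
    (T.boundary_iff _ _).mpr ⟨Path.nil, loop, (Path.nil : Path (tvObs T.J) (tvObs T.J)).cons (ePhi j0),
      rfl, rfl⟩
  have t3' : T.Jfam.E (loop.cons (ePhi j0)) ((Path.nil : Path (tvObs T.J) (tvObs T.J)).cons (ePhi j0)) :=
    (T.boundary_iff _ _).mpr ⟨loop, Path.nil, (Path.nil : Path (tvObs T.J) (tvObs T.J)).cons (ePhi j0),
      rfl, rfl⟩
  have c3 : K.E (pathPhiId 0 j0)
      ((loop.cons (ePhi j0)).cons (show tvRow1 T.J 0 ⟶ tvNexus T.J from LFVertex.idEdge 0)) :=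
    K.isSaturated.postcomp (hJ _ _ t3)
      ((Path.nil : Path (tvRow1 T.J 0) (tvRow1 T.J 0)).cons
        (show tvRow1 T.J 0 ⟶ tvNexus T.J from LFVertex.idEdge 0))
  have c3' : K.E ((loop.cons (ePhi j0)).cons (show tvRow1 T.J 0 ⟶ tvNexus T.J from LFVertex.idEdge 0))
      (pathPhiId 0 j0) :=
    K.isSaturated.postcomp (hJ _ _ t3')
      ((Path.nil : Path (tvRow1 T.J 0) (tvRow1 T.J 0)).cons
        (show tvRow1 T.J 0 ⟶ tvNexus T.J from LFVertex.idEdge 0))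
  -- (4) `η_⋎ : [β¹_⋎] ⇝ [β⁰_⋎]`, pre-composed with `[log]∘[φ_{⋎+1}]` and post-composed with `[id_⋎]`
  have c4 : K.E ((loop.cons (ePhi j0)).cons (show tvRow1 T.J 0 ⟶ tvNexus T.J from LFVertex.idEdge 0))
      ((((Path.nil : Path (tvObs T.J) (tvObs T.J)).cons (ePhi j1)).cons
        (show tvRow1 T.J (0 + 1) ⟶ tvRow1 T.J 0 from LFVertex.logEdge 0)).cons
        (show tvRow1 T.J 0 ⟶ tvNexus T.J from LFVertex.idEdge 0)) :=
    K.isSaturated.precomp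
      (K.isSaturated.postcomp (hC _ _ (ContactGen.etaRow1 0 j0))
        ((Path.nil : Path (tvRow1 T.J 0) (tvRow1 T.J 0)).cons
          (show tvRow1 T.J 0 ⟶ tvNexus T.J from LFVertex.idEdge 0)))
      (((Path.nil : Path (tvObs T.J) (tvObs T.J)).cons (ePhi j1)).cons
        (show tvRow1 T.J (0 + 1) ⟶ tvRow1 T.J 0 from LFVertex.logEdge 0))
  have c4' : K.E ((((Path.nil : Path (tvObs T.J) (tvObs T.J)).cons (ePhi j1)).cons
        (show tvRow1 T.J (0 + 1) ⟶ tvRow1 T.J 0 from LFVertex.logEdge 0)).cons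
        (show tvRow1 T.J 0 ⟶ tvNexus T.J from LFVertex.idEdge 0))
      ((loop.cons (ePhi j0)).cons (show tvRow1 T.J 0 ⟶ tvNexus T.J from LFVertex.idEdge 0)) :=
    K.isSaturated.precomp
      (K.isSaturated.postcomp (hC _ _ (ContactGen.etaRow1Inv 0 j0))
        ((Path.nil : Path (tvRow1 T.J 0) (tvRow1 T.J 0)).cons
          (show tvRow1 T.J 0 ⟶ tvNexus T.J from LFVertex.idEdge 0)))
      (((Path.nil : Path (tvObs T.J) (tvObs T.J)).cons (ePhi j1)).cons
        (show tvRow1 T.J (0 + 1) ⟶ tvRow1 T.J 0 from LFVertex.logEdge 0))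
  -- the isomorphism `[id_{⋎+1}]∘[φ_{⋎+1}] ⇝ [id_⋎]∘[log]∘[φ_{⋎+1}]` and its inverse
  have h₀ := K.isSaturated.trans (K.isSaturated.trans (K.isSaturated.trans c1 c2) c3) c4
  have h₀' := K.isSaturated.trans (K.isSaturated.trans (K.isSaturated.trans c4' c3') c2') c1'
  have hiso : IsIso (K.η h₀) :=
    ⟨K.η h₀', by rw [← K.η_trans h₀ h₀', K.η_refl], by rw [← K.η_trans h₀' h₀, K.η_refl]⟩
  exact false_of_prefixed_core_compatible_of_obstruction_left K
    (w := tvObs T.J) (v1 := tvRow1 T.J (0 + 1)) (v0 := tvRow1 T.J 0) (sq := tvNexus T.J)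
    (ob := tvThird T.J) (ePhi j1) (LFVertex.logEdge 0) (LFVertex.idEdge (0 + 1)) (LFVertex.idEdge 0)
    LFVertex.lamTimesEdge LFVertex.lamPfEdge ι Δ.ιlog h₀ hiso hTm hhTm h₁ hh₁ a₀
    (fun a ha => h34 _ a ha)

end Literature.AnabelianGeometry.AbsoluteAnabelian.LogFrobeniusData
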